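import Literature.NumberTheory.Automorphic.ConjugateSelfDualInfinityType
import Literature.NumberTheory.Automorphic.Liu2021.Thm418AsPrinted
import Literature.NumberTheory.ComplexMultiplication.ReflexCMTypeOrientation
import HarnessLib

/-!
# The CM type `Φ_μ` READ OFF the archimedean components ([Liu 2021] Rem. 4.2 / Def. 4.3): `μ_τ(z) = arg(z)^{−𝚠_τ}` through `τ' ∈ Φ_μ`

Y. Liu, *Fourier–Jacobi cycles and arithmetic relative trace formula*, Camb. J. Math. **9** (2021) = arXiv:2102.11518 [Liu2021], TeX source
`FJcycle.tex` §4.1 (held extraction `paper:arxiv-2102.11518` p0018 L29–L42); [WeilBNT1967] Ch. VII §3; [Shimura1998] §8.4 Example (1).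

AS PRINTED ([Liu2021] l. 1908–1912 = p0018 L31–L35): «For a conjugate symplectic (resp. conjugate orthogonal) automorphic character `μ`, there
exist a CM type `Φ_μ` and a unique tuple `𝚠_μ = (𝚠_τ)_{τ ∈ Φ_F}` of odd (resp. even) nonnegative integers such that for every `τ ∈ Φ_F`, the
component `μ_τ : (E ⊗_{F,τ} ℝ)^× → ℂ^×` is the character `z ↦ arg(z)^{−𝚠_τ}`, where we have identified `(E ⊗_{F,τ} ℝ)^×` with `ℂ^×` via the
unique element `τ' ∈ Φ_μ` above `τ`. If `𝚠_μ` does not contain `0`, then `Φ_μ` is also unique.»  Def. 4.3 (l. 1914–1921 = L37–L42): «(1) We call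
`𝚠_μ` the *weight* of `μ` … (2) If `𝚠_μ` does not contain zero, then we call `Φ_μ` the *CM type* of `μ`.»  (`arg(z) := z/√(z z̄)`, p0004 L26 =
the tree's `Literature.Analysis.Complex.unitPart`.)

PURPOSE (pub-hodgecm2 red team, `hodge-director/TGTBT.md` DELTA 14, D14.3 item 5, verbatim): «What survives of D11.3 item 5 is only the ι-SIDE
identification of `Φ_μ` from `μ_∞` (p306543 invariance + `hμ` binder of the displays: `ι₁.comp g ∈ cmType ↔ ι₁.comp g.symm ∈ Φ` — a READING of
Liu's Def. 4.3 (2)/weight map at every display; its cheapest falsifier is the same toy: compute `hμ.cmType` for the `μ` of `exists_toyDatum_nine`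
against Liu's archimedean-weight definition l. ~1900–1915). Not blocking; audit-side.»  This file puts that identification in the kernel —
generically (every CM field, hence every display) and at the toy.

THE TREE'S SIDE.  `IdeleClassGroup.HasInfinityType L ψ e` (`UnitaryInfinityType`): `ψ[u] = ∏_w arg(ι_w u_w)^{e_w}` on `L_∞ˣ`, the coordinate at
the complex place `w` read through Mathlib's `ι_w = extensionEmbedding w : L_w →+* ℂ` (extending `w.embedding`); `cmTypeOf L e = {φ | exponentAt e φ
< 0}`, `IsConjugateSymplectic.cmType` (`ConjugateSelfDualCharacters`, `ConjugateSelfDualInfinityType`) — the `Φ_μ` of [Liu2021] Thm. 4.18 as typed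
(`Thm418Data.cmType`) and of the S2 END displays' binder `hμ` (`Transposition/Item6SupplyPinnedDef45*.lean`).

WHAT THE KERNEL NOW SAYS (theorems only; 0 `def`, 0 named fact, axioms `[propext, Classical.choice, Quot.sound]`).
§1 ANY CM field `L`, any `ψ : C_L →ₜ* S¹`.  «identified `(E ⊗_{F,τ} ℝ)^×` with `ℂ^×` via `τ'`» := a CONTINUOUS ring homomorphism `φ̂ : L_w →+* ℂ`
extending the complex embedding `φ = τ'` inducing `w`; such a `φ̂` is `ι_w` if `φ = w.embedding` and `conj ∘ ι_w` if `φ = w̄.embedding`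
(private `eq_extensionEmbedding_of_continuous`, `eq_conj_extensionEmbedding_of_continuous`: `L` is dense in `L_w`), hence onto
(private `surjective_of_continuous_of_extends`); the idele «`z` at `τ`» is the tree's `singleUnits L w c` (`c ∈ L_wˣ`, `1` elsewhere).
* `HasInfinityType.apply_singleUnits_eq_zpow_exponentAt`: `ψ[c] = arg(φ̂ c)^{exponentAt e φ}` for EVERY `φ` inducing `w`;
* **`HasInfinityType.apply_singleUnits_of_mem_cmTypeOf`** = THE PRINTED SENTENCE: for `τ' = φ ∈ Φ_e`, `ψ[c] = arg(φ̂ c)^{−𝚠_w}` (`𝚠 = weight e`);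
  `…_of_not_mem_cmTypeOf`: through `τ̄'` it reads `arg^{+𝚠_w}`;
* **`mem_cmTypeOf_iff_apply_singleUnits`** = THE IDENTIFICATION: `φ ∈ Φ_e ↔ ∀ c, ψ[c] = arg(φ̂ c)^{−𝚠_w}` (`←`: `𝚠_w ≠ 0`, `φ̂` onto); at the
  level of characters `HasCMType.mem_iff_apply_singleUnits` (weight `𝔴` from `HasWeight`, the ∞-type being unique); WEIGHT ONE (the `μ` of
  Def. 4.5 / Thm. 4.18): **`IsConjugateSymplectic.mem_cmType_iff_apply_singleUnits`:
  `φ ∈ hμ.cmType ↔ ∀ c, μ[c] = arg(φ̂ c)⁻¹`** (directions `…apply_singleUnits_of_mem_cmType` / `…_of_not_mem_cmType`: `arg⁻¹` / `arg⁺¹`);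
* §3 `Liu2021.Thm418Data.mem_cmType_iff_apply_singleUnits`: the same `iff` for the displays' `(D …).cmType = Thm418Data.cmType` — AT EVERY
  DISPLAY the `Φ_μ` in `hμ` is the set of complex embeddings through which `μ_∞` reads `z ↦ arg(z)^{−1}` (Liu's l. 1908–1912 with `𝚠_μ = 1`),
  not the opposite type `Φ̄_μ = Φ_{μ^c}` (Rem. 4.4).
§2 THE DATUM `E = ℚ(ζ₉)`, `Φ_μ ↔ a(g) ∈ {1,2,4}` through `ι` (`g ζ₉ = ζ₉^{a(g)}`, Mathlib `IsPrimitiveRoot.autToPow`; the hypothesis shape `hΦ` of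
p308157 `exists_cmType_nine` / p309404 `exists_toyDatum_nine`), for EVERY weight-one conjugate symplectic `μ` with that `Φ_μ`:
* `apply_singleUnits_nine_of_mem`: `a(g) ∈ {1,2,4}` ⇒ at the place of `ι ∘ g`, through `ι ∘ g`: **`μ[c] = arg(φ̂ c)⁻¹`**; `…_nine_of_not_mem`:
  `a(g) ∉ {1,2,4}` (`= {5,7,8}`) ⇒ **`μ[c] = arg(φ̂ c)`** (all six embeddings = three places × two identifications);
  `exists_weightOne_cmType_nine`: the datum exists for every `ι` — «`hμ.cmType` for the `μ` of `exists_toyDatum_nine` against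
  the archimedean-weight definition», computed;
* `display_hmu_nine_iff`: the displays' binder `∀ g, ι ∘ g ∈ Φ_μ ↔ ι ∘ g⁻¹ ∈ Φ` holds at the datum IFF `Φ ↔ {1,5,7} = {1,2,4}⁻¹` (the reflex
  type, p308157; [Shimura1998] §8.4 Ex. (1)); `self_mem_of_display_hmu_nine`: then `ι ∈ Φ` (the displays' guard `ι₁ ∈ Φ.1` is met);
  `exists_mem_cmType_not_mem_of_display_hmu_nine`: and `Φ ≠ Φ_μ` (they separate at `σ₂`) — the datum distinguishes the reading «`Φ_μ = Φ*`»
  from «`Φ_μ = Φ`» (at `ℚ(ζ₇)`, `{1,2,4}`, it would not: `S⁻¹ = S̄`).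

WHAT REMAINS A READING: the dictionary `HasInfinityType` ↔ «`μ_τ`, `arg`» itself (module docstring of `ConjugateSelfDualCharacters`); GIVEN it,
`τ' ∈ Φ_μ` is the kernel `iff` above, not a convention.  Not touched: which `Φ` the universe pairs with `Φ_μ` (p308157 ORIENTATION,
p309404 / p309418 VALUE of `η'_μ`).  Mathlib: `InfinitePlace.Completion.{induction_on, extensionEmbedding_coe, surjective_extensionEmbedding_of_isComplex}`,
`embedding_mk_eq`, `IsCyclotomicExtension.autEquivPow`, `decide` on `(ℤ/9)ˣ`.  Tree (nothing restated): `UnitaryInfinityType`,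
`ConjugateSelfDual{Characters,InfinityType}`, `Liu2021/Thm418AsPrinted`, `ComplexMultiplication/ReflexCMTypeOrientation`, `Analysis/Complex/AngularPart`.

## References
* [Liu2021] Y. Liu, Camb. J. Math. 9 (2021) = arXiv:2102.11518 — Remark 4.2 (l. 1908–1912), Def. 4.3 (l. 1914–1921), Rem. 4.4 (l. 1930).
* [WeilBNT1967] A. Weil, *Basic Number Theory*, Springer 1967 — Ch. VII §3.
* [Shimura1998] G. Shimura, *Abelian Varieties with Complex Multiplication and Modular Functions*, Princeton 1998 — §8.4 Example (1).

Provenance: pub-hodgecm2 TEAM hComp seat `hcomp-abcm-2` gen 5, 2026-08-21/22, answering `hodge-director/TGTBT.md` D14.3 item 5.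
HC_CM is NOT proved; count-neutral.
-/

set_option autoImplicit false

noncomputable section

open NumberField NumberField.InfinitePlace NumberField.InfinitePlace.Completion NumberField.ComplexEmbedding
open Literature.AlgebraicGeometry.Motives (CMType)

namespace Literature.NumberTheory.Automorphic

open GaloisRepresentations InfiniteAdeleRing Literature.Analysis.Complex

namespace IdeleClassGroup

/-! ## §1 Any CM field: the component of `ψ` at a place, read through a chosen complex embedding -/

section Extension

variable {L : Type} [Field L]

/-- `arg(z̄) = arg(z)⁻¹` in `S¹` (for `z' ∈ ℂˣ` with value `z̄`). [folklore] -/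
private theorem unitPart_eq_inv_of_coe_eq_conj {z z' : ℂˣ} (h : (z' : ℂ) = starRingEnd ℂ (z : ℂ)) :
    unitPart z' = (unitPart z)⁻¹ :=
  Circle.ext (by rw [Circle.coe_inv_eq_conj, coe_unitPart, coe_unitPart, h, Complex.norm_conj, map_div₀,
    Complex.conj_ofReal])

/-- A continuous ring homomorphism `φ̂ : L_w →+* ℂ` extending `w.embedding` IS `ι_w = extensionEmbedding w` (`L` is dense in `L_w`). [folklore] -/
private theorem eq_extensionEmbedding_of_continuous {w : InfinitePlace L} (φhat : w.Completion →+* ℂ) (hc : Continuous φhat)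
    (hext : ∀ x : L, φhat x = w.embedding x) (y : w.Completion) : φhat y = extensionEmbedding w y := by
  induction y using induction_on with
  | hp => exact isClosed_eq hc (isometry_extensionEmbedding w).continuous
  | ih a => rw [extensionEmbedding_coe]; exact hext (WithAbs.equiv w.1 a)

/-- A continuous ring homomorphism `φ̂ : L_w →+* ℂ` extending the CONJUGATE embedding `w̄.embedding` is `conj ∘ ι_w`. [folklore] -/
private theorem eq_conj_extensionEmbedding_of_continuous {w : InfinitePlace L} (φhat : w.Completion →+* ℂ) (hc : Continuous φhat)
    (hext : ∀ x : L, φhat x = conjugate w.embedding x) (y : w.Completion) :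
    φhat y = starRingEnd ℂ (extensionEmbedding w y) := by
  induction y using induction_on with
  | hp => exact isClosed_eq hc (Complex.continuous_conj.comp (isometry_extensionEmbedding w).continuous)
  | ih a => rw [extensionEmbedding_coe, ← conjugate_coe_eq]; exact hext (WithAbs.equiv w.1 a)

/-- A continuous extension `φ̂ : L_w →+* ℂ` of a complex embedding `φ` inducing a complex `w` is onto (it is `ι_w` or `conj ∘ ι_w`). [folklore] -/
private theorem surjective_of_continuous_of_extends [NumberField L] [IsTotallyComplex L] (w : InfinitePlace L) {φ : L →+* ℂ}
    (hφw : InfinitePlace.mk φ = w) (φhat : w.Completion →+* ℂ) (hc : Continuous φhat) (hext : ∀ x : L, φhat x = φ x) :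
    Function.Surjective φhat := by
  have hsurj := surjective_extensionEmbedding_of_isComplex (IsTotallyComplex.isComplex w)
  rcases (hφw ▸ embedding_mk_eq φ : w.embedding = φ ∨ w.embedding = conjugate φ) with hφ | hφ
  · intro z
    obtain ⟨y, hy⟩ := hsurj z
    exact ⟨y, (eq_extensionEmbedding_of_continuous φhat hc (fun x => by rw [hext, hφ]) y).trans hy⟩
  · have hφ' : φ = conjugate w.embedding := by
      rw [hφ]; ext x; rw [conjugate_coe_eq, conjugate_coe_eq, Complex.conj_conj]
    intro z
    obtain ⟨y, hy⟩ := hsurj (starRingEnd ℂ z)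
    exact ⟨y, by rw [eq_conj_extensionEmbedding_of_continuous φhat hc (fun x => by rw [hext, hφ']) y, hy, Complex.conj_conj]⟩

end Extension

section General

variable {L : Type} [Field L] [NumberField L] [IsCMField L] {ψ : IdeleClassGroup L →ₜ* Circle} {e : InfinitePlace L → ℤ}

/-- **The component at `w` read through ANY complex embedding `φ` inducing `w`**, `L_w ≅ ℂ` via the continuous extension `φ̂` of `φ`: on the
idele `(…, 1, c, 1, …)` at `w` (`singleUnits`), `ψ[c] = arg(φ̂ c)^{exponentAt e φ}` — exponent `e_w` through `w.embedding` (the tree's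
`infinityTypeChar_singleUnits`), `−e_w` through the conjugate embedding (reading `arg` through `φ̄` inverts it). [cite: Liu2021, Remark 4.2] -/
theorem HasInfinityType.apply_singleUnits_eq_zpow_exponentAt (h : HasInfinityType L ψ e) (w : InfinitePlace L) {φ : L →+* ℂ}
    (hφw : InfinitePlace.mk φ = w) (φhat : w.Completion →+* ℂ) (hc : Continuous φhat) (hext : ∀ x : L, φhat x = φ x)
    (c : (w.Completion)ˣ) :
    ψ (infUnitsToClass L (singleUnits L w c)) = unitPart (Units.map φhat.toMonoidHom c) ^ exponentAt e φ := by
  rw [h, infinityTypeChar_singleUnits]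
  rcases (hφw ▸ embedding_mk_eq φ : w.embedding = φ ∨ w.embedding = conjugate φ) with hφ | hφ
  · -- distinguished coordinate: `φ̂ = ι_w`, exponent `e_w`
    have hexp : exponentAt e φ = e w := by unfold exponentAt; rw [hφw, if_pos hφ]
    have hval : (Units.map φhat.toMonoidHom c : ℂˣ) = Units.map (extensionEmbedding w).toMonoidHom c :=
      Units.ext (eq_extensionEmbedding_of_continuous φhat hc (fun x => by rw [hext, hφ]) c)
    rw [hexp, hval]
  · -- conjugate coordinate: `φ̂ = conj ∘ ι_w`, exponent `−e_w`
    have hne : w.embedding ≠ φ := fun h' =>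
      not_isReal_of_mk_isComplex (hφw ▸ IsTotallyComplex.isComplex w) (ComplexEmbedding.isReal_iff.2 (hφ.symm.trans h'))
    have hexp : exponentAt e φ = -e w := by unfold exponentAt; rw [hφw, if_neg hne]
    have hφ' : φ = conjugate w.embedding := by rw [hφ]; ext x; rw [conjugate_coe_eq, conjugate_coe_eq, Complex.conj_conj]
    have hval : unitPart (Units.map φhat.toMonoidHom c) = (unitPart (Units.map (extensionEmbedding w).toMonoidHom c))⁻¹ :=
      unitPart_eq_inv_of_coe_eq_conj (eq_conj_extensionEmbedding_of_continuous φhat hc (fun x => by rw [hext, hφ']) c)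
    rw [hexp, hval, inv_zpow', neg_neg]

/-- **[Liu 2021, Rem. 4.2, l. 1908–1912] IN THE KERNEL — through `τ' ∈ Φ` the component is `arg^{−𝚠}`.**  «the component `μ_τ` … is the
character `z ↦ arg(z)^{−𝚠_τ}`, where we have identified `(E ⊗_{F,τ} ℝ)^×` with `ℂ^×` via the unique element `τ' ∈ Φ_μ` above `τ`»: for `ψ` of
zero-free ∞-type `e`, `τ' = φ ∈ Φ_e = cmTypeOf L e` inducing `w`, `φ̂` the continuous extension of `φ` to `L_w`: `ψ[c] = arg(φ̂ c)^{−𝚠_w}`,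
`𝚠_w = weight e w`. [cite: Liu2021, Remark 4.2 and Def. 4.3] -/
theorem HasInfinityType.apply_singleUnits_of_mem_cmTypeOf (h : HasInfinityType L ψ e) (he : ∀ w, e w ≠ 0) (w : InfinitePlace L)
    {φ : L →+* ℂ} (hφw : InfinitePlace.mk φ = w) (hφ : φ ∈ (cmTypeOf L e he).1) (φhat : w.Completion →+* ℂ)
    (hc : Continuous φhat) (hext : ∀ x : L, φhat x = φ x) (c : (w.Completion)ˣ) :
    ψ (infUnitsToClass L (singleUnits L w c)) = unitPart (Units.map φhat.toMonoidHom c) ^ (-(weight e w : ℤ)) := by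
  rw [h.apply_singleUnits_eq_zpow_exponentAt w hφw φhat hc hext c, exponentAt_eq_neg_weight_of_mem hφ, hφw]

/-- … and through an embedding NOT in `Φ_e` (through `τ̄'`) the same component reads `arg^{+𝚠}`. [cite: Liu2021, Remark 4.2] -/
theorem HasInfinityType.apply_singleUnits_of_not_mem_cmTypeOf (h : HasInfinityType L ψ e) (he : ∀ w, e w ≠ 0)
    (w : InfinitePlace L) {φ : L →+* ℂ} (hφw : InfinitePlace.mk φ = w) (hφ : φ ∉ (cmTypeOf L e he).1)
    (φhat : w.Completion →+* ℂ) (hc : Continuous φhat) (hext : ∀ x : L, φhat x = φ x) (c : (w.Completion)ˣ) :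
    ψ (infUnitsToClass L (singleUnits L w c)) = unitPart (Units.map φhat.toMonoidHom c) ^ (weight e w : ℤ) := by
  rw [h.apply_singleUnits_eq_zpow_exponentAt w hφw φhat hc hext c]
  have h1 : ¬ exponentAt e φ < 0 := hφ
  have h2 := natAbs_exponentAt e φ
  rw [weight_apply, hφw] at *
  congr 1
  omega

/-- **`Φ_μ` IS READ OFF `μ_∞` (the identification, as an `iff`).**  For `ψ` of zero-free ∞-type `e`, a complex embedding `φ` inducing
`w` belongs to `Φ_e = cmTypeOf L e` IFF the `w`-component of `ψ`, read through the continuous extension `φ̂` of `φ`, is `z ↦ arg(z)^{−𝚠_w}`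
— Liu's defining property of «the unique element `τ' ∈ Φ_μ` above `τ`». [cite: Liu2021, Remark 4.2 and Def. 4.3] -/
theorem mem_cmTypeOf_iff_apply_singleUnits (h : HasInfinityType L ψ e) (he : ∀ w, e w ≠ 0) (w : InfinitePlace L)
    {φ : L →+* ℂ} (hφw : InfinitePlace.mk φ = w) (φhat : w.Completion →+* ℂ) (hc : Continuous φhat)
    (hext : ∀ x : L, φhat x = φ x) :
    φ ∈ (cmTypeOf L e he).1 ↔ ∀ c : (w.Completion)ˣ,
      ψ (infUnitsToClass L (singleUnits L w c)) = unitPart (Units.map φhat.toMonoidHom c) ^ (-(weight e w : ℤ)) := by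
  refine ⟨fun hφ c => h.apply_singleUnits_of_mem_cmTypeOf he w hφw hφ φhat hc hext c, fun H => ?_⟩
  by_contra hφ
  -- through `φ ∉ Φ_e` the component is `arg^{+𝚠}`; together with `arg^{−𝚠}` this forces `arg(φ̂ c)^{2𝚠} = 1` for all `c`
  have hd : (2 * (weight e w : ℤ)) ≠ 0 := by
    have : (weight e w : ℤ) ≠ 0 := by rw [weight_apply]; exact_mod_cast Int.natAbs_ne_zero.2 (he w)
    omega
  obtain ⟨ζ, hζ1, hζd⟩ := exists_norm_eq_one_zpow_ne_one hd
  have hζ0 : ζ ≠ 0 := fun h0 => by simp [h0] at hζ1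
  obtain ⟨y, hy⟩ := surjective_of_continuous_of_extends w hφw φhat hc hext ζ
  have hy0 : y ≠ 0 := fun h0 => hζ0 (by rw [← hy, h0, map_zero])
  let cu : (w.Completion)ˣ := Units.mk0 y hy0
  have hval : (unitPart (Units.map φhat.toMonoidHom cu) : ℂ) = ζ := by
    rw [coe_unitPart, show ((Units.map φhat.toMonoidHom cu : ℂˣ) : ℂ) = ζ from hy, hζ1]; simp
  have key := (h.apply_singleUnits_of_not_mem_cmTypeOf he w hφw hφ φhat hc hext cu).symm.trans (H cu)
  have key' : (unitPart (Units.map φhat.toMonoidHom cu)) ^ (2 * (weight e w : ℤ)) = 1 :=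
    calc (unitPart (Units.map φhat.toMonoidHom cu)) ^ (2 * (weight e w : ℤ))
        = (unitPart (Units.map φhat.toMonoidHom cu)) ^ (weight e w : ℤ) *
            (unitPart (Units.map φhat.toMonoidHom cu)) ^ (weight e w : ℤ) := by rw [two_mul, zpow_add]
      _ = (unitPart (Units.map φhat.toMonoidHom cu)) ^ (weight e w : ℤ) *
            (unitPart (Units.map φhat.toMonoidHom cu)) ^ (-(weight e w : ℤ)) := by rw [← key]
      _ = 1 := by rw [← zpow_add, add_neg_cancel, zpow_zero]
  apply hζd
  have := congrArg (fun z : Circle => (z : ℂ)) key'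
  simp only [Circle.coe_zpow, Circle.coe_one, hval] at this
  exact this

/-! ### At the level of characters: `HasCMType` / `HasWeight`, and `IsConjugateSymplectic.cmType` -/

/-- **The CM type of a character is identified from its archimedean components** (`iff`, weight `𝔴`).
[cite: Liu2021, Remark 4.2 and Def. 4.3] -/
theorem HasCMType.mem_iff_apply_singleUnits {Φ : CMType L} (hΦ : HasCMType L ψ Φ) {𝔴 : InfinitePlace L → ℕ}
    (h𝔴 : HasWeight L ψ 𝔴) (w : InfinitePlace L) {φ : L →+* ℂ} (hφw : InfinitePlace.mk φ = w)
    (φhat : w.Completion →+* ℂ) (hc : Continuous φhat) (hext : ∀ x : L, φhat x = φ x) :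
    φ ∈ Φ.1 ↔ ∀ c : (w.Completion)ˣ,
      ψ (infUnitsToClass L (singleUnits L w c)) = unitPart (Units.map φhat.toMonoidHom c) ^ (-(𝔴 w : ℤ)) := by
  obtain ⟨e, he, hinf, rfl⟩ := hΦ
  obtain ⟨e', he', rfl⟩ := h𝔴
  obtain rfl := hasInfinityType_unique hinf he'
  exact mem_cmTypeOf_iff_apply_singleUnits hinf he w hφw φhat hc hext

variable {μ : IdeleClassGroup L →ₜ* Circle}

/-- **WEIGHT ONE (the `μ` of [Liu 2021] Def. 4.5 / Thm. 4.18): `Φ_μ = {τ' : μ read through τ' is z ↦ arg(z)⁻¹}`.**  For `μ` conjugate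
symplectic of weight one, a complex embedding `τ' = φ` inducing `w` lies in the tree's `Φ_μ = hμ.cmType` (the `(D …).cmType` of the
displays' binder `hμ`) IFF the `w`-component of `μ`, with `L_w ≅ ℂ` «via `τ'`» (the continuous extension `φ̂`), is `z ↦ arg(z)^{−1}`.
[cite: Liu2021, Remark 4.2 and Def. 4.3] -/
theorem IsConjugateSymplectic.mem_cmType_iff_apply_singleUnits (hμ : IsConjugateSymplectic L μ) (h1 : HasWeight L μ 1)
    (w : InfinitePlace L) {φ : L →+* ℂ} (hφw : InfinitePlace.mk φ = w) (φhat : w.Completion →+* ℂ) (hc : Continuous φhat)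
    (hext : ∀ x : L, φhat x = φ x) :
    φ ∈ hμ.cmType.1 ↔ ∀ c : (w.Completion)ˣ,
      μ (infUnitsToClass L (singleUnits L w c)) = (unitPart (Units.map φhat.toMonoidHom c))⁻¹ := by
  rw [hμ.hasCMType_cmType.mem_iff_apply_singleUnits h1 w hφw φhat hc hext]
  simp only [Pi.one_apply, Nat.cast_one, zpow_neg, zpow_one]

/-- Weight one, `τ' ∈ Φ_μ`: the component is `arg⁻¹`. [cite: Liu2021, Remark 4.2 and Def. 4.3] -/
theorem IsConjugateSymplectic.apply_singleUnits_of_mem_cmType (hμ : IsConjugateSymplectic L μ) (h1 : HasWeight L μ 1)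
    (w : InfinitePlace L) {φ : L →+* ℂ} (hφw : InfinitePlace.mk φ = w) (hφ : φ ∈ hμ.cmType.1) (φhat : w.Completion →+* ℂ)
    (hc : Continuous φhat) (hext : ∀ x : L, φhat x = φ x) (c : (w.Completion)ˣ) :
    μ (infUnitsToClass L (singleUnits L w c)) = (unitPart (Units.map φhat.toMonoidHom c))⁻¹ :=
  (hμ.mem_cmType_iff_apply_singleUnits h1 w hφw φhat hc hext).1 hφ c

/-- Weight one, `τ' ∉ Φ_μ` (i.e. `τ̄' ∈ Φ_μ`): the component is `arg^{+1}`. [cite: Liu2021, Remark 4.2 and Def. 4.3] -/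
theorem IsConjugateSymplectic.apply_singleUnits_of_not_mem_cmType (hμ : IsConjugateSymplectic L μ) (h1 : HasWeight L μ 1)
    (w : InfinitePlace L) {φ : L →+* ℂ} (hφw : InfinitePlace.mk φ = w) (hφ : φ ∉ hμ.cmType.1) (φhat : w.Completion →+* ℂ)
    (hc : Continuous φhat) (hext : ∀ x : L, φhat x = φ x) (c : (w.Completion)ˣ) :
    μ (infUnitsToClass L (singleUnits L w c)) = unitPart (Units.map φhat.toMonoidHom c) := by
  have hw : weight hμ.infinityType w = 1 := congrFun (hμ.weightOf_eq h1) w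
  have h := hμ.hasInfinityType_infinityType.apply_singleUnits_of_not_mem_cmTypeOf hμ.infinityType_ne_zero w hφw hφ
    φhat hc hext c
  rw [hw] at h; simpa using h

end General

/-! ## §2 The datum `E = ℚ(ζ₉)`, `Φ_μ ↔ {σ₁, σ₂, σ₄}` through `ι` (the toy of p308157 / p309404): components and the `hμ` reading -/

section Nine

variable (L : Type) [Field L] [NumberField L] [IsCMField L] [IsGalois ℚ L] [IsCyclotomicExtension {9} ℚ L]

/-- `Φ₉` is irreducible over `ℚ`. [folklore] -/
private theorem irreducible_cyclotomic_nine : Irreducible (Polynomial.cyclotomic 9 ℚ) :=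
  Polynomial.cyclotomic.irreducible_rat (by norm_num)

omit [IsCMField L] [IsGalois ℚ L] in
/-- `a : Gal(ℚ(ζ₉)/ℚ) → (ℤ/9)ˣ` is onto (it is Mathlib's `autEquivPow` on elements). [folklore] -/
private theorem autToPow_surjective :
    Function.Surjective ((IsCyclotomicExtension.zeta_spec 9 ℚ L).autToPow ℚ : (L ≃ₐ[ℚ] L) → (ZMod 9)ˣ) :=
  fun u => ⟨(IsCyclotomicExtension.autEquivPow L (irreducible_cyclotomic_nine)).symm u,
    MulEquiv.apply_symm_apply (IsCyclotomicExtension.autEquivPow L (irreducible_cyclotomic_nine)) u⟩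

variable {L} in
omit [IsCMField L] [IsGalois ℚ L] in
/-- `a(g⁻¹) = a(g)⁻¹`. [folklore] -/
private theorem autToPow_symm (g : L ≃ₐ[ℚ] L) :
    (IsCyclotomicExtension.zeta_spec 9 ℚ L).autToPow ℚ g.symm = ((IsCyclotomicExtension.zeta_spec 9 ℚ L).autToPow ℚ g)⁻¹ := by
  rw [← map_inv]
  rfl

omit [IsGalois ℚ L] in
/-- **THE RED TEAM'S FALSIFIER, through `σ₁, σ₂, σ₄`** (TGTBT D14.3 item 5: «compute `hμ.cmType` for the `μ` of `exists_toyDatum_nine` against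
Liu's archimedean-weight definition»).  On `E = ℚ(ζ₉)` let `μ` be conjugate symplectic of weight one with tree CM type `Φ_μ = hμ.cmType =
{ι ∘ σ_a : a ∈ {1,2,4}}` (`σ_a : ζ₉ ↦ ζ₉^a`).  Then for `a(g) ∈ {1,2,4}`, at the place of `τ' = ι ∘ g` with `E_{τ'} ≅ ℂ` via the continuous
extension `φ̂` of `τ'`: `μ[c] = arg(φ̂ c)^{−1}` — the printed «`z ↦ arg(z)^{−𝚠_τ}` via `τ' ∈ Φ_μ`», `𝚠 = 1`. [cite: Liu2021, Remark 4.2 and Def. 4.3] -/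
theorem apply_singleUnits_nine_of_mem (ι : L →+* ℂ) {μ : IdeleClassGroup L →ₜ* Circle} (hμ : IsConjugateSymplectic L μ)
    (h1 : HasWeight L μ 1) (hΦ : ∀ g : L ≃ₐ[ℚ] L,
      ι.comp (g : L →+* L) ∈ hμ.cmType.1 ↔ ((IsCyclotomicExtension.zeta_spec 9 ℚ L).autToPow ℚ g : ZMod 9) ∈ ({1, 2, 4} : Finset (ZMod 9)))
    (g : L ≃ₐ[ℚ] L) (hg : ((IsCyclotomicExtension.zeta_spec 9 ℚ L).autToPow ℚ g : ZMod 9) ∈ ({1, 2, 4} : Finset (ZMod 9)))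
    (φhat : (InfinitePlace.mk (ι.comp (g : L →+* L))).Completion →+* ℂ) (hc : Continuous φhat)
    (hext : ∀ x : L, φhat x = ι (g x)) (c : ((InfinitePlace.mk (ι.comp (g : L →+* L))).Completion)ˣ) :
    μ (infUnitsToClass L (singleUnits L (InfinitePlace.mk (ι.comp (g : L →+* L))) c)) =
      (unitPart (Units.map φhat.toMonoidHom c))⁻¹ :=
  hμ.apply_singleUnits_of_mem_cmType h1 _ rfl ((hΦ g).2 hg) φhat hc (fun x => hext x) c

omit [IsGalois ℚ L] in
/-- **… and through `σ₅, σ₇, σ₈` (`a(g) ∉ {1,2,4}`: the conjugates `τ̄'`, NOT in `Φ_μ`) the same components read `arg^{+1}`** — so at this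
datum the tree's `Φ_μ` is Liu's `Φ_μ` (the coordinates with exponent `−𝚠 = −1`), not `Φ̄_μ = Φ_{μ^c}` (Rem. 4.4); with the previous theorem
this covers all six complex embeddings (three places × two identifications). [cite: Liu2021, Remark 4.2 and Def. 4.3] -/
theorem apply_singleUnits_nine_of_not_mem (ι : L →+* ℂ) {μ : IdeleClassGroup L →ₜ* Circle} (hμ : IsConjugateSymplectic L μ)
    (h1 : HasWeight L μ 1) (hΦ : ∀ g : L ≃ₐ[ℚ] L,
      ι.comp (g : L →+* L) ∈ hμ.cmType.1 ↔ ((IsCyclotomicExtension.zeta_spec 9 ℚ L).autToPow ℚ g : ZMod 9) ∈ ({1, 2, 4} : Finset (ZMod 9)))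
    (g : L ≃ₐ[ℚ] L) (hg : ((IsCyclotomicExtension.zeta_spec 9 ℚ L).autToPow ℚ g : ZMod 9) ∉ ({1, 2, 4} : Finset (ZMod 9)))
    (φhat : (InfinitePlace.mk (ι.comp (g : L →+* L))).Completion →+* ℂ) (hc : Continuous φhat)
    (hext : ∀ x : L, φhat x = ι (g x)) (c : ((InfinitePlace.mk (ι.comp (g : L →+* L))).Completion)ˣ) :
    μ (infUnitsToClass L (singleUnits L (InfinitePlace.mk (ι.comp (g : L →+* L))) c)) =
      unitPart (Units.map φhat.toMonoidHom c) :=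
  hμ.apply_singleUnits_of_not_mem_cmType h1 _ rfl (fun h => hg ((hΦ g).1 h)) φhat hc (fun x => hext x) c

/-- **The datum exists** (tree `exists_isConjugateSymplectic_hasCMType`, [WeilBNT1967] VII §3, at the type `{σ₁,σ₂,σ₄}` of p308157): for every
`ι` a weight-one conjugate symplectic `μ` on `ℚ(ζ₉)` with `Φ_μ ↔ {1,2,4}` through `ι`; by the two theorems above its components through `ι ∘ g`
are `arg^{−1}` (`a(g) ∈ {1,2,4}`) and `arg^{+1}` (`a(g) ∈ {5,7,8}`, the complement). [cite: Liu2021, Remark 4.2 and Def. 4.3] -/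
theorem exists_weightOne_cmType_nine (ι : L →+* ℂ) :
    ∃ (μ : IdeleClassGroup L →ₜ* Circle) (hμ : IsConjugateSymplectic L μ), HasWeight L μ 1 ∧
      ∀ g : L ≃ₐ[ℚ] L,
        ι.comp (g : L →+* L) ∈ hμ.cmType.1 ↔ ((IsCyclotomicExtension.zeta_spec 9 ℚ L).autToPow ℚ g : ZMod 9) ∈ ({1, 2, 4} : Finset (ZMod 9)) := by
  obtain ⟨Φ, hΦ⟩ := Literature.NumberTheory.ComplexMultiplication.exists_cmType_nine L ι
  obtain ⟨μ, hμ, hw, hμΦ⟩ := exists_isConjugateSymplectic_hasCMType Φ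
  obtain rfl : hμ.cmType = Φ := hμ.cmType_eq hμΦ
  exact ⟨μ, hμ, hw, hΦ⟩

omit [IsGalois ℚ L] in
/-- **THE DISPLAYS' BINDER `hμ` EVALUATED AT THE DATUM.**  The S2 END displays (`Transposition/Item6SupplyPinnedDef45*.lean`) choose `μ` by
`hμ : ∀ g, ι₁ ∘ g ∈ Φ_μ ↔ ι₁ ∘ g⁻¹ ∈ Φ` («`Φ_μ = Φ^{*ι₁}`»).  At `ℚ(ζ₉)` with `Φ_μ ↔ {1,2,4}` that binder holds for `Φ` IFF `Φ ↔ {1,5,7} =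
{1,2,4}⁻¹` through `ι` — the reflex type of `Φ_μ` (p308157 `comp_smul_val_mem_reflexCMType_nine_iff`). [cite: Shimura1998, §8.4 Example (1)] -/
theorem display_hmu_nine_iff (ι : L →+* ℂ) {μ : IdeleClassGroup L →ₜ* Circle} (hμ : IsConjugateSymplectic L μ)
    (hΦμ : ∀ g : L ≃ₐ[ℚ] L,
      ι.comp (g : L →+* L) ∈ hμ.cmType.1 ↔ ((IsCyclotomicExtension.zeta_spec 9 ℚ L).autToPow ℚ g : ZMod 9) ∈ ({1, 2, 4} : Finset (ZMod 9))) (Φ : CMType L) :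
    (∀ g : L ≃ₐ[ℚ] L, ι.comp (g : L →+* L) ∈ hμ.cmType.1 ↔ ι.comp (g.symm : L →+* L) ∈ Φ.1) ↔
      ∀ g : L ≃ₐ[ℚ] L,
        ι.comp (g : L →+* L) ∈ Φ.1 ↔ ((IsCyclotomicExtension.zeta_spec 9 ℚ L).autToPow ℚ g : ZMod 9) ∈ ({1, 5, 7} : Finset (ZMod 9)) := by
  have key : ∀ u : (ZMod 9)ˣ,
      ((u⁻¹ : (ZMod 9)ˣ) : ZMod 9) ∈ ({1, 2, 4} : Finset (ZMod 9)) ↔ (u : ZMod 9) ∈ ({1, 5, 7} : Finset (ZMod 9)) := by decide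
  constructor
  · intro H g
    have h := H g.symm
    rw [AlgEquiv.symm_symm, hΦμ, autToPow_symm, key] at h
    exact h.symm
  · intro H g
    rw [hΦμ, H, autToPow_symm, ← key, inv_inv]

omit [IsCMField L] [IsGalois ℚ L] in
/-- Under that reading the universe-side type `Φ ↔ {1,5,7}` CONTAINS the presenting embedding `ι` (`a(1) = 1`): the displays' guard
`ι₁ ∈ Φ.1` is met at the datum. [cite: Shimura1998, §8.4 Example (1)] -/
theorem self_mem_of_display_hmu_nine (ι : L →+* ℂ) (Φ : CMType L)
    (hΦ : ∀ g : L ≃ₐ[ℚ] L, ι.comp (g : L →+* L) ∈ Φ.1 ↔ ((IsCyclotomicExtension.zeta_spec 9 ℚ L).autToPow ℚ g : ZMod 9) ∈ ({1, 5, 7} : Finset (ZMod 9))) :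
    ι ∈ Φ.1 := by
  have h := (hΦ 1).2 (by rw [map_one]; decide)
  have h1 : ι.comp ((1 : L ≃ₐ[ℚ] L) : L →+* L) = ι := RingHom.ext fun _ => rfl
  rwa [h1] at h

omit [IsGalois ℚ L] in
/-- … and `Φ ≠ Φ_μ`: `ι ∘ σ₂ ∈ Φ_μ` but `ι ∘ σ₂ ∉ Φ` (`σ₂` exists, `a` being onto `(ℤ/9)ˣ`).  So the datum SEPARATES the displays' reading
«`Φ_μ = Φ*`» from «`Φ_μ = Φ`» (at `ℚ(ζ₇)`, `{1,2,4}`, it would not: there `S⁻¹ = S̄`). [cite: Shimura1998, §8.4 Example (1)] -/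
theorem exists_mem_cmType_not_mem_of_display_hmu_nine (ι : L →+* ℂ) {μ : IdeleClassGroup L →ₜ* Circle}
    (hμ : IsConjugateSymplectic L μ) (hΦμ : ∀ g : L ≃ₐ[ℚ] L,
      ι.comp (g : L →+* L) ∈ hμ.cmType.1 ↔ ((IsCyclotomicExtension.zeta_spec 9 ℚ L).autToPow ℚ g : ZMod 9) ∈ ({1, 2, 4} : Finset (ZMod 9))) (Φ : CMType L)
    (hΦ : ∀ g : L ≃ₐ[ℚ] L, ι.comp (g : L →+* L) ∈ hμ.cmType.1 ↔ ι.comp (g.symm : L →+* L) ∈ Φ.1) :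
    ∃ g : L ≃ₐ[ℚ] L, ι.comp (g : L →+* L) ∈ hμ.cmType.1 ∧ ι.comp (g : L →+* L) ∉ Φ.1 := by
  have hΦ' := (display_hmu_nine_iff L ι hμ hΦμ Φ).1 hΦ
  obtain ⟨g, hg⟩ := autToPow_surjective L ⟨2, 5, by decide, by decide⟩
  refine ⟨g, (hΦμ g).2 ?_, fun h => ?_⟩
  · rw [hg]; decide
  · have h' := (hΦ' g).1 h
    rw [hg] at h'
    revert h'; decide

end Nine

end IdeleClassGroup

/-! ## §3 At the displays: `(D …).cmType = Thm418Data.cmType` -/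

namespace Liu2021.Thm418Data

open IdeleClassGroup

/-- **AT EVERY DISPLAY.**  For the data `D` of [Liu 2021, Thm. 4.18] as typed (`Thm418Data F E`: `D.μ` conjugate symplectic of weight one,
`D.cmType = Φ_μ` — the `(D F ι₁ V Φ).cmType` of the S2 displays' binder `hμ`): a complex embedding `τ' = φ` of `E` inducing the place `w`
lies in `Φ_μ` IFF the `w`-component of `μ`, with `E_w ≅ ℂ` via the continuous extension `φ̂` of `τ'`, is `z ↦ arg(z)^{−1}`.
[cite: Liu2021, Remark 4.2 and Def. 4.3] -/
theorem mem_cmType_iff_apply_singleUnits {F E : Type} [Field F] [NumberField F] [IsTotallyReal F] [Field E] [NumberField E]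
    [Algebra F E] [IsTotallyComplex E] [Algebra.IsQuadraticExtension F E] (D : Thm418Data F E) (w : InfinitePlace E)
    {φ : E →+* ℂ} (hφw : InfinitePlace.mk φ = w) (φhat : w.Completion →+* ℂ) (hc : Continuous φhat)
    (hext : ∀ x : E, φhat x = φ x) :
    φ ∈ D.cmType.1 ↔ ∀ c : (w.Completion)ˣ,
      D.μ (infUnitsToClass E (singleUnits E w c)) = (unitPart (Units.map φhat.toMonoidHom c))⁻¹ := by
  letI : IsCMField E := isCMField F E
  exact D.isConjugateSymplectic.mem_cmType_iff_apply_singleUnits D.hasWeight_one w hφw φhat hc hext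

end Liu2021.Thm418Data

end Literature.NumberTheory.Automorphic
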